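/-
Origin: expansion seat `prover-pub-hodgecm-mc-binder-2-g14-0`, handover #N1 2026-08-20T11:00Z md5 0843e9101cff (NEW 0843e9101cff; 177 l.; K_V-letter twins at the swapped data: `linSubst_emb_of_eq_sigmaPosSwap/NegSwap`, `linSubst_kV_placePoly_of_eq_sigmaPosSwap/NegSwap` (same proofs as PlaceEigen/VLetterSigma/VLetterSigmaNeg); imports VLetterSigma + VLetterSigmaNeg; NAME LIST: HodgeCM.Model.HypCensus.linSubst_kV_placePoly_of_eq_sigmaPosSwap · HodgeCM.Model.HypCensus.linSubst_kV_placePoly_of_eq_sigmaNegSwap · HodgeCM.Model.HypCensus.linSubst_emb_of_eq_sigmaPosSwap) (`HOME/mc/pub-hodgecm-mc-binder-2/g14/t12/HodgeCM/Model/HypCensus/VLetterSigmaSwap.lean`, md5 0843e9101cff, 177 lines);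
landed by the second packager p2 gen 7 (p2-g7) in gate run 50 as `HodgeCM/Model/HypCensus/VLetterSigmaSwap.lean` (verbatim).
-/
/-
Copyright (c) 2026. All rights reserved.
Released under Apache 2.0 license as described in the file LICENSE.
-/
import Summits.HodgeConjecture.HodgeCM.Model.HypCensus.VLetterSigma
import Summits.HodgeConjecture.HodgeCM.Model.HypCensus.VLetterSigmaNeg

/-!
# Census kit (rows A12/A34), (T12): the `K_V`-letter eigen-lemmas at a `Σ₁₂` place of SWAPPED printed orientation

RULING SUPPLEMENT 5 (B1), 2026-08-20: the census datum at a `Σ₁₂` place with `ε_b = −1` is `PlaceDatum.sigmaPosSwap` /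
`sigmaNegSwap` (kind `sigmaSwap`, printed model `LocalFock.ofPrintMCircleSwap`; data = those of `sigmaPos` / `sigmaNeg`).  The
`K_V`-letters do not see the torus orientation, so the four lemmas of `PlaceEigen` §1 / `VLetterSigma` / `VLetterSigmaNeg` hold at the
swapped data VERBATIM; this leaf records the twins (same proofs): `linSubst_emb_of_eq_sigmaPosSwap` / `_sigmaNegSwap`,
`linSubst_kV_placePoly_of_eq_sigmaPosSwap` / `_sigmaNegSwap`.  KERNEL only; nothing here is a claim of PerL/QW8.
-/

set_option autoImplicit false

noncomputable section

open NumberField NumberField.InfinitePlace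
open scoped Classical
open MvPolynomial
open Literature.NumberTheory.Automorphic Literature.NumberTheory.Automorphic.UnitaryGroup Literature.NumberTheory.Weil1964
open Literature.RepresentationTheory.KonnoKonno2007 Literature.RepresentationTheory.KonnoKonno2007.RealDualPair
open Literature.NumberTheory.GelbartRogawski1991 Literature.NumberTheory.GelbartRogawski1991.UnitaryDualPair
open Literature.Analysis.SegalBargmann
open HodgeCM.PerL34.Fock HodgeCM.PerL34.Fock.PrintDict

namespace HodgeCM.Model.HypCensus

section Place

variable (L : Type) [Field L] [NumberField L] [IsCMField L]
variable (dV : Fin 3 → L) (hdV : ∀ i, IsCMField.complexConj L (dV i) = dV i)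
variable (dW : Fin 2 → L) (hdW : ∀ i, IsCMField.complexConj L (dW i) = dW i) (ι₁ : L →+* ℂ)
variable (v : {v : InfinitePlace ↥(maximalRealSubfield L) // v.IsReal})

/-- **Σ₁₂ place, `V` read positive: a substitution fixing every `rename idx (P^k)` fixes every printed vector.** -/
theorem linSubst_emb_of_eq_sigmaPosSwap (eA : Fin 3 ≃ PosIdx (cmXV L dV hdV ι₁ v)) (hQ : IsEmpty (NegIdx (cmXV L dV hdV ι₁ v)))
    (r₀ : PosIdx (cmXW L dV dW hdW ι₁ v)) (s₀ : NegIdx (cmXW L dV dW hdW ι₁ v))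
    (hR : Subsingleton (PosIdx (cmXW L dV dW hdW ι₁ v))) (hS : Subsingleton (NegIdx (cmXW L dV dW hdW ι₁ v)))
    (M : Matrix (Fin 6) (Fin 6) ℂ)
    (hP : ∀ k : ℕ, linSubst M (rename (PlaceDatum.sigmaPosSwap eA hQ r₀ s₀ hR hS : PlaceDatum L dV hdV dW hdW ι₁ v).idx
        (HodgeCM.PerL34.Fock.P ^ k)) = rename (PlaceDatum.sigmaPosSwap eA hQ r₀ s₀ hR hS : PlaceDatum L dV hdV dW hdW ι₁ v).idx
        (HodgeCM.PerL34.Fock.P ^ k)) :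
    ∀ (d : PlaceDatum L dV hdV dW hdW ι₁ v), d = PlaceDatum.sigmaPosSwap eA hQ r₀ s₀ hR hS → ∀ (vac : Circle × Circle →* Circle)
      (y : (printLoc d.lam d.lam_ne_zero vac d.kind).M), linSubst M (d.emb vac y) = d.emb vac y := by
  rintro d rfl vac y
  change linSubst M (rename (PlaceDatum.sigmaPosSwap eA hQ r₀ s₀ hR hS : PlaceDatum L dV hdV dW hdW ι₁ v).idx (kappaPartM.subtype y)) =
    rename (PlaceDatum.sigmaPosSwap eA hQ r₀ s₀ hR hS : PlaceDatum L dV hdV dW hdW ι₁ v).idx (kappaPartM.subtype y)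
  have hy := (show ↥kappaPartM from y).2
  rw [Submodule.subtype_apply]
  refine Submodule.span_induction (p := fun f _ => linSubst M (rename _ f) = rename _ f) ?_ ?_ ?_ ?_ hy
  · rintro _ ⟨k, rfl⟩; exact hP k
  · rw [map_zero, map_zero]
  · intro f g _ _ hf hg; rw [map_add, map_add, hf, hg]
  · intro a f _ hf; rw [map_smul, map_smul, hf]

/-- **Σ₁₂ place, `V` read negative**: the same. -/
theorem linSubst_emb_of_eq_sigmaNegSwap (eA : Fin 3 ≃ NegIdx (cmXV L dV hdV ι₁ v)) (hP0 : IsEmpty (PosIdx (cmXV L dV hdV ι₁ v)))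
    (r₀ : PosIdx (cmXW L dV dW hdW ι₁ v)) (s₀ : NegIdx (cmXW L dV dW hdW ι₁ v))
    (hR : Subsingleton (PosIdx (cmXW L dV dW hdW ι₁ v))) (hS : Subsingleton (NegIdx (cmXW L dV dW hdW ι₁ v)))
    (M : Matrix (Fin 6) (Fin 6) ℂ)
    (hP : ∀ k : ℕ, linSubst M (rename (PlaceDatum.sigmaNegSwap eA hP0 r₀ s₀ hR hS : PlaceDatum L dV hdV dW hdW ι₁ v).idx
        (HodgeCM.PerL34.Fock.P ^ k)) = rename (PlaceDatum.sigmaNegSwap eA hP0 r₀ s₀ hR hS : PlaceDatum L dV hdV dW hdW ι₁ v).idx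
        (HodgeCM.PerL34.Fock.P ^ k)) :
    ∀ (d : PlaceDatum L dV hdV dW hdW ι₁ v), d = PlaceDatum.sigmaNegSwap eA hP0 r₀ s₀ hR hS → ∀ (vac : Circle × Circle →* Circle)
      (y : (printLoc d.lam d.lam_ne_zero vac d.kind).M), linSubst M (d.emb vac y) = d.emb vac y := by
  rintro d rfl vac y
  change linSubst M (rename (PlaceDatum.sigmaNegSwap eA hP0 r₀ s₀ hR hS : PlaceDatum L dV hdV dW hdW ι₁ v).idx (kappaPartM.subtype y)) =
    rename (PlaceDatum.sigmaNegSwap eA hP0 r₀ s₀ hR hS : PlaceDatum L dV hdV dW hdW ι₁ v).idx (kappaPartM.subtype y)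
  have hy := (show ↥kappaPartM from y).2
  rw [Submodule.subtype_apply]
  refine Submodule.span_induction (p := fun f _ => linSubst M (rename _ f) = rename _ f) ?_ ?_ ?_ ?_ hy
  · rintro _ ⟨k, rfl⟩; exact hP k
  · rw [map_zero, map_zero]
  · intro f g _ _ hf hg; rw [map_add, map_add, hf, hg]
  · intro a f _ hf; rw [map_smul, map_smul, hf]

end Place

section Datum

variable (L : Type) [Field L] [NumberField L] [IsCMField L]
variable (dV : Fin 3 → L) (hdV : ∀ i, IsCMField.complexConj L (dV i) = dV i)
variable (dW : Fin 2 → L) (hdW : ∀ i, IsCMField.complexConj L (dW i) = dW i) (ι₁ : L →+* ℂ)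
variable (datum : ∀ b : InfinitePlace L, PlaceDatum L dV hdV dW hdW ι₁ (cmPlacesEquiv L b)) (m₁ m₂ : InfinitePlace L → ℤ)

/-- **Σ₁₂ place read positive: every place polynomial is FIXED by every `K_V`-letter `((A,D),(1,1))`.** -/
theorem linSubst_kV_placePoly_of_eq_sigmaPosSwap (b : InfinitePlace L)
    (eA : Fin 3 ≃ PosIdx (cmXV L dV hdV ι₁ (cmPlacesEquiv L b))) (hQ : IsEmpty (NegIdx (cmXV L dV hdV ι₁ (cmPlacesEquiv L b))))
    (r₀ : PosIdx (cmXW L dV dW hdW ι₁ (cmPlacesEquiv L b))) (s₀ : NegIdx (cmXW L dV dW hdW ι₁ (cmPlacesEquiv L b)))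
    (hR : Subsingleton (PosIdx (cmXW L dV dW hdW ι₁ (cmPlacesEquiv L b)))) (hS : Subsingleton (NegIdx (cmXW L dV dW hdW ι₁ (cmPlacesEquiv L b))))
    (hσ : datum b = PlaceDatum.sigmaPosSwap eA hQ r₀ s₀ hR hS)
    (A : Matrix.unitaryGroup (PosIdx (cmXV L dV hdV ι₁ (cmPlacesEquiv L b))) ℂ)
    (D : Matrix.unitaryGroup (NegIdx (cmXV L dV hdV ι₁ (cmPlacesEquiv L b))) ℂ)
    (m : ∀ b : InfinitePlace L, ((printPlaces (InfinitePlace L) (kindOf L dV hdV dW hdW ι₁ datum)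
      (lamOf L dV hdV dW hdW ι₁ datum) (lamOf_ne_zero L dV hdV dW hdW ι₁ datum)
      (pinnedVacs (kindOf L dV hdV dW hdW ι₁ datum) m₁ m₂)).loc b).M) :
    linSubst (star ((reindexUnitary (pairFrame (PosIdx (cmXV L dV hdV ι₁ (cmPlacesEquiv L b))) (NegIdx (cmXV L dV hdV ι₁ (cmPlacesEquiv L b)))
        (PosIdx (cmXW L dV dW hdW ι₁ (cmPlacesEquiv L b))) (NegIdx (cmXW L dV dW hdW ι₁ (cmPlacesEquiv L b))) finProdFinEquiv
        (cmEpsV L dV hdV ι₁ (cmPlacesEquiv L b)) (cmEpsW L dV dW hdW ι₁ (cmPlacesEquiv L b)))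
        (dualPairι (((A, D), (1, 1)) : DPK (PosIdx (cmXV L dV hdV ι₁ (cmPlacesEquiv L b))) (NegIdx (cmXV L dV hdV ι₁ (cmPlacesEquiv L b)))
          (PosIdx (cmXW L dV dW hdW ι₁ (cmPlacesEquiv L b))) (NegIdx (cmXW L dV dW hdW ι₁ (cmPlacesEquiv L b))))) :
          Matrix.unitaryGroup (Fin 6) ℂ) : Matrix (Fin 6) (Fin 6) ℂ))
        (placePoly L dV hdV dW hdW ι₁ datum m₁ m₂ m (cmPlacesEquiv L b)) =
      placePoly L dV hdV dW hdW ι₁ datum m₁ m₂ m (cmPlacesEquiv L b) := by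
  rw [placePoly_apply]
  refine linSubst_emb_of_eq_sigmaPosSwap L dV hdV dW hdW ι₁ _ eA hQ r₀ s₀ hR hS _ (fun k => ?_) (datum b) hσ _ (m b)
  have hidx : ((PlaceDatum.sigmaPosSwap eA hQ r₀ s₀ hR hS : PlaceDatum L dV hdV dW hdW ι₁ (cmPlacesEquiv L b)).idx :
      HodgeCM.PerL34.Fock.MixedVar → Fin 6) =
      (pairFrame (PosIdx (cmXV L dV hdV ι₁ (cmPlacesEquiv L b))) (NegIdx (cmXV L dV hdV ι₁ (cmPlacesEquiv L b)))
        (PosIdx (cmXW L dV dW hdW ι₁ (cmPlacesEquiv L b))) (NegIdx (cmXW L dV dW hdW ι₁ (cmPlacesEquiv L b))) finProdFinEquiv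
        (cmEpsV L dV hdV ι₁ (cmPlacesEquiv L b)) (cmEpsW L dV dW hdW ι₁ (cmPlacesEquiv L b))).symm ∘
        mixedToDPIdx (NegIdx (cmXV L dV hdV ι₁ (cmPlacesEquiv L b))) eA r₀ s₀ := by
    funext x
    change (cmIdx L dV hdV dW hdW ι₁ (cmPlacesEquiv L b)).symm (mixedToDPIdx _ eA r₀ s₀ x) = _
    rw [cmIdx_eq_pairFrame]
    rfl
  have hre : rename ((PlaceDatum.sigmaPosSwap eA hQ r₀ s₀ hR hS : PlaceDatum L dV hdV dW hdW ι₁ (cmPlacesEquiv L b)).idx)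
        (HodgeCM.PerL34.Fock.P ^ k) =
      rename (pairFrame (PosIdx (cmXV L dV hdV ι₁ (cmPlacesEquiv L b))) (NegIdx (cmXV L dV hdV ι₁ (cmPlacesEquiv L b)))
        (PosIdx (cmXW L dV dW hdW ι₁ (cmPlacesEquiv L b))) (NegIdx (cmXW L dV dW hdW ι₁ (cmPlacesEquiv L b))) finProdFinEquiv
        (cmEpsV L dV hdV ι₁ (cmPlacesEquiv L b)) (cmEpsW L dV dW hdW ι₁ (cmPlacesEquiv L b))).symm
        (rename (mixedToDPIdx (NegIdx (cmXV L dV hdV ι₁ (cmPlacesEquiv L b))) eA r₀ s₀) (HodgeCM.PerL34.Fock.P ^ k)) := by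
    rw [rename_rename]
    exact congrArg (fun j => rename j (HodgeCM.PerL34.Fock.P ^ k)) hidx
  rw [hre, linSubst_star_reindexUnitary_rename, linSubst_star_dualPairι_kV_rename_P_pow]

/-- **Σ₁₂ place read negative: every place polynomial is FIXED by every `K_V`-letter `((A,D),(1,1))`.** -/
theorem linSubst_kV_placePoly_of_eq_sigmaNegSwap (b : InfinitePlace L)
    (eA : Fin 3 ≃ NegIdx (cmXV L dV hdV ι₁ (cmPlacesEquiv L b))) (hP0 : IsEmpty (PosIdx (cmXV L dV hdV ι₁ (cmPlacesEquiv L b))))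
    (r₀ : PosIdx (cmXW L dV dW hdW ι₁ (cmPlacesEquiv L b))) (s₀ : NegIdx (cmXW L dV dW hdW ι₁ (cmPlacesEquiv L b)))
    (hR : Subsingleton (PosIdx (cmXW L dV dW hdW ι₁ (cmPlacesEquiv L b)))) (hS : Subsingleton (NegIdx (cmXW L dV dW hdW ι₁ (cmPlacesEquiv L b))))
    (hσ : datum b = PlaceDatum.sigmaNegSwap eA hP0 r₀ s₀ hR hS)
    (A : Matrix.unitaryGroup (PosIdx (cmXV L dV hdV ι₁ (cmPlacesEquiv L b))) ℂ)
    (D : Matrix.unitaryGroup (NegIdx (cmXV L dV hdV ι₁ (cmPlacesEquiv L b))) ℂ)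
    (m : ∀ b : InfinitePlace L, ((printPlaces (InfinitePlace L) (kindOf L dV hdV dW hdW ι₁ datum)
      (lamOf L dV hdV dW hdW ι₁ datum) (lamOf_ne_zero L dV hdV dW hdW ι₁ datum)
      (pinnedVacs (kindOf L dV hdV dW hdW ι₁ datum) m₁ m₂)).loc b).M) :
    linSubst (star ((reindexUnitary (pairFrame (PosIdx (cmXV L dV hdV ι₁ (cmPlacesEquiv L b))) (NegIdx (cmXV L dV hdV ι₁ (cmPlacesEquiv L b)))
        (PosIdx (cmXW L dV dW hdW ι₁ (cmPlacesEquiv L b))) (NegIdx (cmXW L dV dW hdW ι₁ (cmPlacesEquiv L b))) finProdFinEquiv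
        (cmEpsV L dV hdV ι₁ (cmPlacesEquiv L b)) (cmEpsW L dV dW hdW ι₁ (cmPlacesEquiv L b)))
        (dualPairι (((A, D), (1, 1)) : DPK (PosIdx (cmXV L dV hdV ι₁ (cmPlacesEquiv L b))) (NegIdx (cmXV L dV hdV ι₁ (cmPlacesEquiv L b)))
          (PosIdx (cmXW L dV dW hdW ι₁ (cmPlacesEquiv L b))) (NegIdx (cmXW L dV dW hdW ι₁ (cmPlacesEquiv L b))))) :
          Matrix.unitaryGroup (Fin 6) ℂ) : Matrix (Fin 6) (Fin 6) ℂ))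
        (placePoly L dV hdV dW hdW ι₁ datum m₁ m₂ m (cmPlacesEquiv L b)) =
      placePoly L dV hdV dW hdW ι₁ datum m₁ m₂ m (cmPlacesEquiv L b) := by
  rw [placePoly_apply]
  refine linSubst_emb_of_eq_sigmaNegSwap L dV hdV dW hdW ι₁ _ eA hP0 r₀ s₀ hR hS _ (fun k => ?_) (datum b) hσ _ (m b)
  have hidx : ((PlaceDatum.sigmaNegSwap eA hP0 r₀ s₀ hR hS : PlaceDatum L dV hdV dW hdW ι₁ (cmPlacesEquiv L b)).idx :
      HodgeCM.PerL34.Fock.MixedVar → Fin 6) =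
      (pairFrame (PosIdx (cmXV L dV hdV ι₁ (cmPlacesEquiv L b))) (NegIdx (cmXV L dV hdV ι₁ (cmPlacesEquiv L b)))
        (PosIdx (cmXW L dV dW hdW ι₁ (cmPlacesEquiv L b))) (NegIdx (cmXW L dV dW hdW ι₁ (cmPlacesEquiv L b))) finProdFinEquiv
        (cmEpsV L dV hdV ι₁ (cmPlacesEquiv L b)) (cmEpsW L dV dW hdW ι₁ (cmPlacesEquiv L b))).symm ∘
        mixedToDPIdxNeg (PosIdx (cmXV L dV hdV ι₁ (cmPlacesEquiv L b))) eA r₀ s₀ := by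
    funext x
    change (cmIdx L dV hdV dW hdW ι₁ (cmPlacesEquiv L b)).symm (mixedToDPIdxNeg _ eA r₀ s₀ x) = _
    rw [cmIdx_eq_pairFrame]
    rfl
  have hre : rename ((PlaceDatum.sigmaNegSwap eA hP0 r₀ s₀ hR hS : PlaceDatum L dV hdV dW hdW ι₁ (cmPlacesEquiv L b)).idx)
        (HodgeCM.PerL34.Fock.P ^ k) =
      rename (pairFrame (PosIdx (cmXV L dV hdV ι₁ (cmPlacesEquiv L b))) (NegIdx (cmXV L dV hdV ι₁ (cmPlacesEquiv L b)))
        (PosIdx (cmXW L dV dW hdW ι₁ (cmPlacesEquiv L b))) (NegIdx (cmXW L dV dW hdW ι₁ (cmPlacesEquiv L b))) finProdFinEquiv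
        (cmEpsV L dV hdV ι₁ (cmPlacesEquiv L b)) (cmEpsW L dV dW hdW ι₁ (cmPlacesEquiv L b))).symm
        (rename (mixedToDPIdxNeg (PosIdx (cmXV L dV hdV ι₁ (cmPlacesEquiv L b))) eA r₀ s₀) (HodgeCM.PerL34.Fock.P ^ k)) := by
    rw [rename_rename]
    exact congrArg (fun j => rename j (HodgeCM.PerL34.Fock.P ^ k)) hidx
  rw [hre, linSubst_star_reindexUnitary_rename, linSubst_star_dualPairι_kV_rename_P_pow_neg]

end Datum

end HodgeCM.Model.HypCensus

end
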